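import Literature.NumberTheory.Transcendental.RoySmallValueStep2Pkg
import Literature.NumberTheory.Transcendental.RoySmallValueEstimatesZeroCycleProofs
import Literature.NumberTheory.Transcendental.RoySmallValueEstimatesPhiTranslatesProofs
import Literature.NumberTheory.Transcendental.RoySmallValueEstimatesAlgPointLiouvilleProofs
import Mathlib.FieldTheory.IsAlgClosed.Basic
import Literature.NumberTheory.Transcendental.RoySmallValueOrbitSelection
import Literature.NumberTheory.Transcendental.RoySmallValueOrbitVanishing
import Literature.NumberTheory.Transcendental.RoySmallValueEstimatesClosestGamPProofs
import Literature.NumberTheory.Transcendental.RoySmallValueEstimatesCor16CoreProofs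
import HarnessLib

/-!
# Small value estimates at rational translates (Nguyen–Roy 2016) — proofs: Proposition 15, the subvariety `Z_D`, and Corollary 16

Proofs file towards `Literature.NumberTheory.Transcendental.nguyenRoy2016_thm_1` (Nguyen–Roy, IJNT 12
(2016) = arXiv:1412.5163): **§5, Proposition 15 and Corollary 16** — the convex body `𝒞_D`, the
height gain, the test-family form of Proposition 15 (via the first half `h_{𝒞_D}(ℙ²) ≤ −TU + …` of
`RoySmallValueEstimatesPhiTranslatesProofs` and the product inequality / orbit selection / orbit
vanishing of the Roy 2013 seat), the identification of the selected Galois orbit with the conjugate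
set of an algebraic point (the `pts` of `NguyenRoy.EndgameData`), and Corollary 16 through
Proposition 10. Everything here is PROVED; no named facts; all constants symbolic (the "for `D`
large enough" numerics are left to the assembly). Built on the pair package `NguyenRoy.PairPkg` of
`RoySmallValueEstimatesZeroCycleProofs`. Four parts:

### Part 1: Proposition 15 in test-family form (the convex body `𝒞_D` and the height gain)

Part 1 is the translation analogue of the Roy 2013 seat's `RoySmallValueStep2Pkg` /
`RoySmallValueLevelGain` (which do exactly this for Roy's derivation `𝒟` and `Q = ∑ tⁱ𝒟ⁱP̃`), for
the package `NguyenRoy.PairPkg D P̃ Q̃` of ANY coprime pair of integer forms (`RoySmallValueEstimatesZeroCycleProofs`) and the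
Nguyen–Roy convex body:

* `nrBody D ξ η r s Y U T = {R ∈ ℂ[X]_D ; ‖R‖ ≤ e^Y, |R(1, ξ + ir, ηsⁱ)| ≤ e^{−U} (i < T)}` —
  `𝒞_D` with symbolic `Y, U, T` (`Y = 2D^β`-ish, `U = D^ν/2`, `T = ⌊D^σ⌋` in the paper);
  `zero_mem_nrBody`, `nrBody_convex` (convex in Roy's sense);
* `PairPkg.height_le_log_leading_sup` — the height GAIN `(D/[K:ℚ]) ∑ⱼ eⱼ h_K(rep j) ≤ log|c| +
  D ∑ⱼ eⱼ log‖αⱼ‖` ([R2012] Prop. 2.3: "`log|a| ≥ D h(Z) − …`", constant improved to `0`), ported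
  from `Roy2013.LevelPkg.height_le_log_leading_sup`; `log_leading_sup_nonneg`;
* **`PairPkg.step2_family_le`** — for `P̃, Q̃ ∈ 𝒞` and every family of tests `Rⱼ ∈ 𝒞`:
  `|c| ∏ⱼ |Rⱼ(αⱼ)|^{eⱼ} ≤ 2^{2k2^k} · e^{−TU} N! (3e^Y)^N` (`N = binom(3D+2,2)`, `D² ≤ 2^k`), from the
  first half of Proposition 15 (`royPhi_le_of_small_at_translates`, `RoySmallValueEstimatesPhiTranslatesProofs`: `h_{𝒞_D}(ℙ²)`-bound
  for `Φ` at translates) and the product inequality `Roy2013.step2_core`;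
* **`PairPkg.step2_family_normalised_le`** — the same with SUP-normalised points and the height
  of `W` on the favourable side:
  `∏ⱼ (|Rⱼ(αⱼ)|/‖αⱼ‖^D)^{eⱼ} ≤ 2^{2k2^k} e^{−TU} N!(3e^Y)^N · exp(−(1/[K:ℚ]) ∑ⱼ eⱼ D h_K(rep j))` —
  the input of the orbit selection `Roy2013.ZeroConfigK.exists_orb_forall_prod_le`
  (`RoySmallValueOrbitSelection`) and of `ZeroConfigK.aeval_eq_zero_of_orbit_bound`
  (`RoySmallValueOrbitVanishing`), which then yield `Z_D` (Proposition 15) and `Z_D ⊆ W_D`.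

### Part 2: the points of `W` are algebraic; Galois orbits of `W` = conjugate sets

The `ℚ`-subvarieties `Z ⊆ W = 𝒵(P̃, Q̃)` of §5 appear in two guises in this development: as the
Galois ORBITS `(L.cfg K hK).orb j₀ ⊆ Fin L.m` of the normalised representatives of a pair package
`L : NguyenRoy.PairPkg D P̃ Q̃` (`RoySmallValueEstimatesZeroCycleProofs`; `Roy2013.ZeroConfigK` of the Roy 2013 seat, over a normal
number field `K ⊆ ℂ` containing the coordinates), on which the small-value machinery
(`RoySmallValueOrbitSelection`, `…OrbitVanishing`) operates, and as the CONJUGATE SETS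
`AlgPt.conj` of algebraic points (`RoySmallValueEstimatesAlgPointProofs`), the `pts` of the endgame
structure `NguyenRoy.EndgameData`. Part 2 identifies them:

* `PairPkg.pivot_α`, `nrm_α`, `nv_pt`, `Kp_pt_le` — the representatives `αⱼ` are normalised exactly
  as `nv` normalises (first non-zero coordinate `= 1`), so `nv [αⱼ] = αⱼ` and `ℚ([αⱼ]) ⊆ K`;
* `PairPkg.presPt`, **`isAlgPt_pt`**, `algPt j : AlgPt` — the points of `W` are algebraic;
* **`conj_algPt_eq_image`** — `conj [αⱼ] = {[σ(rep j)] : σ : K →ₐ[ℚ] ℂ}` (extension of embeddings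
  from `ℚ([αⱼ])` to `K`, `IsAlgClosed.surjective_restrictDomain_of_isAlgebraic`);
* **`image_orb_pt_eq_conj`** — `{[α_i] : i ∈ orb j₀} = conj [α_{j₀}]` (the quoted sentence);
  `card_orb_eq_deg` (`#orb = deg`), **`sum_orb_habs_eq_ht`** and `sum_orb_logHeight_div_eq_ht`
  (`∑_{i∈orb j₀} h_abs([αᵢ]) = (∑_{i ∈ orb j₀} h_K(rep i))/[K:ℚ] = ht [α_{j₀}] = deg · h_abs`, the
  height `h(O)` of the Roy 2013 seat's orbit inequalities versus the `ht` of `EndgameData`).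

### Part 3: Proposition 15 — the subvariety `Z_D` and `Z_D ⊆ W_D`

For a pair package `L : NguyenRoy.PairPkg D P̃ Q̃` (`RoySmallValueEstimatesZeroCycleProofs`) with `P̃, Q̃` in the Nguyen–Roy
convex body `𝒞 = nrBody D ξ η r s Y U T` (Part 1), a normal number field `K ⊆ ℂ` containing the
coordinates and a weight parameter `Y' > 0`, we SELECT a Galois orbit `O = orb j₀` of the points of
`W = 𝒵(P̃, Q̃)` — the subvariety `Z_D := [α_{j₀}]` as an algebraic point (`L.algPt j₀`, Part 2,
with `conj Z_D = {[αⱼ] : j ∈ O}`) — such that, with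
`S₀ = 2^{2k2^k} e^{−TU} N!(3e^Y)^N < 1` (Proposition 15, first half + Step 2) and
`B = Y'D² + D ∑ⱼ eⱼ h_abs([αⱼ]) ≤ Y'D² + log 𝓛(Φ(P̃, Q̃, ·))`:

* **`exists_orb_prod_le`** — for EVERY family `Rⱼ ∈ 𝒞` (`j ∈ O`):
  `∏_{j∈O} |Rⱼ(αⱼ)|/‖αⱼ‖^D ≤ S₀^{(Y' deg Z_D + D ht Z_D)/B} · e^{−D ht Z_D}` — the printed
  `h_𝒞(Z_D) ≤ −(TU/(7D²Y))(Y deg Z_D + D h(Z_D))` combined with [R2012, Prop. 2.3]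
  (`∑_α log sup_𝒞 |P(α̲)| ≤ h_𝒞(Z_D) − D h(Z_D) + …`), in the test-family / Weil-height currency
  of this development (`ht = deg · h_abs`), obtained from `PairPkg.step2_family_normalised_le`
  (Part 1) by the orbit selection `Roy2013.exists_orb_forall_prod_le` of the Roy 2013 seat
  with weights `w_O = Y' #O + D ∑_{j∈O} h_abs([αⱼ])`;
* **`eval_eq_zero_of_mem_body`** — every INTEGER form of degree `D` whose complexification lies
  in `𝒞` vanishes at all points of `conj Z_D` (the selected bound beats `D h(O)` by the positive
  margin `−(w_O/B) log S₀`, so Liouville's inequality on the orbit,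
  `Roy2013.ZeroConfigK.aeval_eq_zero_of_orbit_bound`, forces vanishing) — applied to the integral
  translates `ΦⁱP̃_D ∈ 𝒞` this is `Z_D ⊆ W_D`;
* bookkeeping: `eO`/`eO_orb` (multiplicities are constant on orbits), `wO`, `sum_eO_mul_wO`
  (`∑_O e_O w_O = Y'D² + D∑ⱼ eⱼ h_abs([αⱼ])`), `mul_sum_e_habs_le` (`D ∑ⱼ eⱼ h_abs([αⱼ]) ≤ log 𝓛(F₀)`).

### Part 4: Corollary 16 (the points of `Z_D` are close to the `γᵢ`)

In the test-family currency of this development the "upper bound provided by Proposition 15" is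
the orbit bound of Part 3 (`PairPkg.exists_orb_prod_le'`: for every family `Rⱼ ∈ 𝒞` on the
selected orbit `O` — whose points form `conj Z_D` — `∏_{j∈O} |Rⱼ(αⱼ)|/‖αⱼ‖^D ≤ M`), and
Proposition 10 is the instantiation's `NguyenRoy.exists_pdist_gamP_le` (file
`RoySmallValueEstimatesClosestGamPProofs`). Part 4 performs the quoted combination, choosing
for each point the test `Rⱼ = (e^Y/𝓛(Pⱼ)) Pⱼ ∈ 𝒞` with `Pⱼ ∈ I_D^{(T)}` witnessing the
contrapositive of Proposition 10 at half the distance to the closest `γᵢ`: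

* `c10_pos`; `exists_test_of_pdist_pos` (with `l1Norm_pos_of_ne_zero` of `RoySmallValueEstimatesCor16CoreProofs`) — for a point `[v]` at positive distance `d` from its
  closest `γᵢ` (`i < T`) there is `P ∈ I_D^{(T)}` with `|P(v)| > 𝓛(P)‖v‖^D · d/(2c₁₀)`;
  `smul_mem_nrBody` — `(e^Y/𝓛(P))P ∈ 𝒞`;
* **`PairPkg.cor16_of_orbit_bound`** — from the orbit bound `≤ M` and `dist(q, γᵢ) > 0`:
  there is a closest-point index `ι` with `ι q < T` and
  `∑_{q ∈ conj Z_D} (Y − log(2c₁₀) + log dist(q, γ_{ι q})) ≤ log M`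
  (with `Y = 2D^β`, `log(2c₁₀) ≤ D^β/2` and `log M = ((Y deg + D ht)/B) log S₀ − D ht` this is the
  printed inequality; the constants stay symbolic here).

## References

* [NguyenRoy2016] N. A. V. Nguyen, D. Roy, *A small value estimate in dimension two involving
  translations by rational points*, IJNT 12 (2016) 1273–1293 = arXiv:1412.5163, §§4–5
  (Lemma 11, Propositions 14, 15, Corollary 16, Proposition 10).
* [Roy2013] D. Roy, *A small value estimate for 𝔾ₐ × 𝔾ₘ*, Mathematika 59 (2013), 333–363
  (arXiv:1301.0663), Propositions 2.3, 2.4, 6.1, 6.2, 6.4 (the arguments being transposed).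
-/

noncomputable section

open MvPolynomial Finset Module Height NumberField
open scoped Matrix Classical

namespace Literature.NumberTheory.Transcendental

namespace NguyenRoy

open Roy2013
open Nesterenko hiding tau

/-! ### The convex body `𝒞_D` -/

/-- **The Nguyen–Roy convex body** `𝒞 = {R ∈ ℂ[X]_D ; ‖R‖ ≤ e^Y, |R(1, ξ + ir, ηsⁱ)| ≤ e^{−U}
(0 ≤ i < T)}`. [cite: NguyenRoy2016, §5 (definition of `𝒞_D`)] -/
def nrBody (D : ℕ) (ξ η r s : ℂ) (Y U : ℝ) (T : ℕ) : Set CX :=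
  {R | R.IsHomogeneous D ∧ maxNorm R ≤ Real.exp Y ∧
    ∀ i : ℕ, i < T → ‖eval ![1, ξ + i * r, η * s ^ i] R‖ ≤ Real.exp (-U)}

/-- Membership, unfolded. [folklore] -/
theorem mem_nrBody {D : ℕ} {ξ η r s : ℂ} {Y U : ℝ} {T : ℕ} {R : CX} :
    R ∈ nrBody D ξ η r s Y U T ↔ R.IsHomogeneous D ∧ maxNorm R ≤ Real.exp Y ∧
      ∀ i : ℕ, i < T → ‖eval ![1, ξ + i * r, η * s ^ i] R‖ ≤ Real.exp (-U) := Iff.rfl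

/-- `0 ∈ 𝒞`. [folklore] -/
theorem zero_mem_nrBody (D : ℕ) (ξ η r s : ℂ) (Y U : ℝ) (T : ℕ) :
    (0 : CX) ∈ nrBody D ξ η r s Y U T := by
  refine ⟨isHomogeneous_zero _ _ _, by rw [maxNorm_zero]; exact (Real.exp_pos _).le, fun i _ => ?_⟩
  rw [map_zero, norm_zero]
  exact (Real.exp_pos _).le

/-- **`𝒞` is convex in Roy's sense**: `aR + bS ∈ 𝒞` for `R, S ∈ 𝒞`, `|a| + |b| ≤ 1`.
[cite: NguyenRoy2016, §5 ("`λP + μQ ∈ 𝒞_D` for `|λ| + |μ| ≤ 1`")] -/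
theorem nrBody_convex (D : ℕ) (ξ η r s : ℂ) (Y U : ℝ) (T : ℕ) :
    ∀ R ∈ nrBody D ξ η r s Y U T, ∀ S ∈ nrBody D ξ η r s Y U T, ∀ a b : ℂ, ‖a‖ + ‖b‖ ≤ 1 →
      a • R + b • S ∈ nrBody D ξ η r s Y U T := by
  intro R hR S hS a b hab
  obtain ⟨hRh, hRn, hRv⟩ := hR
  obtain ⟨hSh, hSn, hSv⟩ := hS
  refine ⟨?_, ?_, fun i hi => ?_⟩
  · rw [smul_eq_C_mul, smul_eq_C_mul]
    exact (hRh.C_mul a).add (hSh.C_mul b)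
  · rw [smul_eq_C_mul, smul_eq_C_mul]
    calc maxNorm (C a * R + C b * S) ≤ maxNorm (C a * R) + maxNorm (C b * S) := maxNorm_add_le _ _
      _ = ‖a‖ * maxNorm R + ‖b‖ * maxNorm S := by rw [maxNorm_C_mul, maxNorm_C_mul]
      _ ≤ ‖a‖ * Real.exp Y + ‖b‖ * Real.exp Y := by
          gcongr
      _ = (‖a‖ + ‖b‖) * Real.exp Y := by ring
      _ ≤ 1 * Real.exp Y := by gcongr
      _ = Real.exp Y := one_mul _
  · rw [smul_eq_C_mul, smul_eq_C_mul, map_add, map_mul, map_mul, eval_C, eval_C]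
    calc ‖a * eval ![1, ξ + i * r, η * s ^ i] R + b * eval ![1, ξ + i * r, η * s ^ i] S‖
        ≤ ‖a‖ * ‖eval ![1, ξ + i * r, η * s ^ i] R‖ + ‖b‖ * ‖eval ![1, ξ + i * r, η * s ^ i] S‖ := by
          refine (norm_add_le _ _).trans ?_
          rw [norm_mul, norm_mul]
      _ ≤ ‖a‖ * Real.exp (-U) + ‖b‖ * Real.exp (-U) := by
          gcongr
          · exact hRv i hi
          · exact hSv i hi
      _ = (‖a‖ + ‖b‖) * Real.exp (-U) := by ring
      _ ≤ 1 * Real.exp (-U) := by gcongr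
      _ = Real.exp (-U) := one_mul _

/-- A larger body: `𝒞(Y, U, T) ⊆ 𝒞(Y', U', T')` for `Y ≤ Y'`, `U' ≤ U`, `T' ≤ T`. [folklore] -/
theorem nrBody_mono {D : ℕ} {ξ η r s : ℂ} {Y Y' U U' : ℝ} {T T' : ℕ} (hY : Y ≤ Y') (hU : U' ≤ U)
    (hT : T' ≤ T) : nrBody D ξ η r s Y U T ⊆ nrBody D ξ η r s Y' U' T' := by
  rintro R ⟨hRh, hRn, hRv⟩
  refine ⟨hRh, hRn.trans (Real.exp_le_exp.mpr hY), fun i hi => (hRv i (lt_of_lt_of_le hi hT)).trans ?_⟩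
  exact Real.exp_le_exp.mpr (neg_le_neg hU)

/-! ### The height gain for a pair package -/

namespace PairPkg

variable {D : ℕ} {Pt Qt : MvPolynomial (Fin 3) ℤ} (L : PairPkg D Pt Qt) (K : IntermediateField ℚ ℂ)
  (hK : ∀ i k, L.α i k ∈ K)

/-- The complex factorisation of `F₀ = intF` in `ZeroConfigK` form. [folklore] -/
theorem map_intF_eq_prod_cfg :
    map (Int.castRingHom ℂ) L.intF = C L.c * ∏ i, evalForm D ((L.cfg K hK).α i) ^ L.e i := by
  rw [map_intF, cfg_α]; exact L.hFeq

/-- Exact multiplicities, in `ZeroConfigK` form. [folklore] -/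
theorem hemax_cfg (i : Fin L.m) (k : ℕ)
    (h : evalForm D ((L.cfg K hK).α i) ^ k ∣ map (Int.castRingHom ℂ) L.intF) : k ≤ L.e i := by
  rw [map_intF, cfg_α] at h
  exact L.hemax i k h

/-- **`log|a| ≥ D h(W)` for the sup-normalised leading constant** of the factorisation
`Φ(P̃, Q̃, ·) = c ∏ ℓ_{αⱼ}^{eⱼ}`: `(D/[K:ℚ]) ∑ⱼ eⱼ h_K(rep j) ≤ log|c| + D ∑ⱼ eⱼ log‖αⱼ‖` (stated
multiplied by `[K:ℚ]`), `K ⊆ ℂ` a normal number field containing the coordinates.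
[cite: Roy2013, Proposition 2.3 and §6 (6.5); NguyenRoy2016, proof of Proposition 15 ("we follow almost word for word the proof of [R2012, Prop. 6.2]")] -/
theorem height_le_log_leading_sup [Normal ℚ K] [NumberField K] :
    ∑ j, (L.e j : ℝ) * (D * logHeight ((L.cfg K hK).rep j)) ≤
      Module.finrank ℚ K * (Real.log ‖L.c‖ + D * ∑ j, (L.e j : ℝ) * Real.log ‖L.α j‖) := by
  classical
  set Z := L.cfg K hK with hZ
  -- the factorisation over `K`
  obtain ⟨A, hA, hfacK⟩ := exists_factorisation_fld Z (L.map_intF_eq_prod_cfg K hK)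
  have h := sum_mul_height_le_sum_emb_veronese L.intF_ne_zero (fun j => Z.rep_ne_zero j) hfacK
  refine h.trans (le_of_eq ?_)
  -- `σ A = c` and `‖σ ∘ rep j‖ = ‖α (perm g j)‖`
  have hσA : ∀ σ : K →+* ℂ, ‖σ A‖ = ‖L.c‖ := by
    intro σ
    rw [← ZeroConfigK.coe_autOfEmb σ A,
      coe_algEquiv_leading_eq Z (L.map_intF_eq_prod_cfg K hK) (L.hemax_cfg K hK) hfacK]
  have hσrep : ∀ (σ : K →+* ℂ) j, ‖(σ ∘ Z.rep j : Fin 3 → ℂ)‖ =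
      ‖L.α (Z.perm (ZeroConfigK.autOfEmb σ) j)‖ := by
    intro σ j
    rw [Z.emb_comp_rep σ j]; rfl
  simp_rw [hσA, hσrep]
  -- sum over embeddings = sum over automorphisms, then re-index each by `perm g`
  have hinner : ∀ g : K ≃ₐ[ℚ] K, ∑ j, (L.e j : ℝ) * Real.log ‖L.α (Z.perm g j)‖ =
      ∑ j, (L.e j : ℝ) * Real.log ‖L.α j‖ := by
    intro g
    have h1 : ∀ j, (L.e j : ℝ) * Real.log ‖L.α (Z.perm g j)‖ =
        (L.e (Z.perm g j) : ℝ) * Real.log ‖L.α (Z.perm g j)‖ := fun j => by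
      rw [mult_perm Z (L.map_intF_eq_prod_cfg K hK) (L.hemax_cfg K hK) g j]
    simp_rw [h1]
    exact Equiv.sum_comp (Z.permEquiv g) (fun j => (L.e j : ℝ) * Real.log ‖L.α j‖)
  rw [Finset.sum_add_distrib, Finset.sum_const, card_univ, nsmul_eq_mul,
    ZeroConfigK.sum_emb_eq_sum_aut (fun g => (D : ℝ) * ∑ j, (L.e j : ℝ) * Real.log ‖L.α (Z.perm g j)‖)]
  simp_rw [hinner]
  rw [Finset.sum_const, card_univ, nsmul_eq_mul, ZeroConfigK.card_aut_eq_finrank K,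
    NumberField.Embeddings.card]
  ring

/-- **`a_sup ≥ 1`**: `0 ≤ log|c| + D ∑ⱼ eⱼ log‖αⱼ‖` (heights are non-negative).
[cite: Roy2013, Proposition 2.4 (proof: "As `log|a| ≥ 0`")] -/
theorem log_leading_sup_nonneg [Normal ℚ K] [NumberField K] (hK : ∀ i k, L.α i k ∈ K) :
    0 ≤ Real.log ‖L.c‖ + D * ∑ j, (L.e j : ℝ) * Real.log ‖L.α j‖ := by
  have h := L.height_le_log_leading_sup K hK
  have hn : (0 : ℝ) < Module.finrank ℚ K := by exact_mod_cast Module.finrank_pos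
  have h0 : 0 ≤ ∑ j, (L.e j : ℝ) * (D * logHeight ((L.cfg K hK).rep j)) :=
    Finset.sum_nonneg fun j _ => mul_nonneg (Nat.cast_nonneg _)
      (mul_nonneg (Nat.cast_nonneg _) (logHeight_nonneg _))
  nlinarith

/-! ### Step 2: Proposition 15 in test-family form -/

/-- `∑ e_i = D² ≤ 2^k` whenever `D² ≤ 2^k`. [folklore] -/
theorem sum_e_le_two_pow {k : ℕ} (hk : D ^ 2 ≤ 2 ^ k) : ∑ i, L.e i ≤ 2 ^ k := by
  rw [L.hesum, L.hcard]; exact hk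

omit K hK in
/-- **Proposition 15, test-family form**: for `P̃, Q̃ ∈ 𝒞 = nrBody D ξ η r s Y U T` and every
family `Rⱼ ∈ 𝒞`, `|c| ∏ⱼ |Rⱼ(αⱼ)|^{eⱼ} ≤ 2^{2k2^k} · e^{−TU} N! (3e^Y)^N` (`N = binom(3D+2, 2)`,
`D² ≤ 2^k`, `T ≤ binom(L'+2, 2)`, `L' ≤ D`, `r ≠ 0`, `η ≠ 0`, `|s| > 1`, interpolation constant
`interpConst(L') ≤ e^Y`). [cite: NguyenRoy2016, Proposition 15 (proof: `h_{𝒞_D}(ℙ²) ≤ −TU + …`,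
then "[R2012, Prop. 6.2] word for word"); Roy2013, Propositions 2.3–2.4, 6.2] -/
theorem step2_family_le {ξ η r s : ℂ} (hr : r ≠ 0) (hη : η ≠ 0) (hs : 1 < ‖s‖) {T Li : ℕ}
    (hTL : T ≤ (Li + 2).choose 2) (hLD : Li ≤ D) {Y U : ℝ} (hU : 0 ≤ U)
    (hY : interpConst ξ η r s Li ≤ Real.exp Y)
    (hPmem : map (Int.castRingHom ℂ) Pt ∈ nrBody D ξ η r s Y U T)
    (hQmem : map (Int.castRingHom ℂ) Qt ∈ nrBody D ξ η r s Y U T)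
    {k : ℕ} (hk : D ^ 2 ≤ 2 ^ k) (t : Fin L.m → CX) (ht : ∀ i, t i ∈ nrBody D ξ η r s Y U T) :
    ‖L.c‖ * ∏ i, ‖eval (L.α i) (t i)‖ ^ L.e i ≤
      2 ^ (2 * k * 2 ^ k) * (Real.exp (-(T * U)) *
        ((Fintype.card (PhiRow D)).factorial * (3 * Real.exp Y) ^ Fintype.card (PhiRow D))) := by
  have hB : ∀ R ∈ nrBody D ξ η r s Y U T,
      ‖royPhi D L.M₁ L.M₂ L.σ ![map (Int.castRingHom ℂ) Pt, map (Int.castRingHom ℂ) Qt, R]‖ ≤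
        Real.exp (-(T * U)) *
          ((Fintype.card (PhiRow D)).factorial * (3 * Real.exp Y) ^ Fintype.card (PhiRow D)) := by
    intro R hR
    refine royPhi_le_of_small_at_translates hr hη hs hTL hLD hU hY L.hM₁ L.hM₂ L.σ
      (fun j => ?_) (fun j => ?_) (fun j => ?_)
    · fin_cases j
      · exact L.hP
      · exact L.hQ
      · exact hR.1
    · fin_cases j
      · exact hPmem.2.1
      · exact hQmem.2.1
      · exact hR.2.1
    · fin_cases j
      · exact hPmem.2.2
      · exact hQmem.2.2
      · exact hR.2.2
  exact step2_core L.hM₁ L.hM₂ L.σ L.hc L.hFeq (nrBody_convex D ξ η r s Y U T)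
    ⟨0, zero_mem_nrBody D ξ η r s Y U T⟩ (fun R hR => hR.1) hB k (L.sum_e_le_two_pow hk) t ht

/-- **Proposition 15, sup-normalised form with the height gain**: for every family `Rⱼ ∈ 𝒞`,
`∏ⱼ (|Rⱼ(αⱼ)|/‖αⱼ‖^D)^{eⱼ} ≤ 2^{2k2^k} e^{−TU} N! (3e^Y)^N · exp(−(1/[K:ℚ]) ∑ⱼ eⱼ D h_K(rep j))`
("`h_𝒞(Z) − D h(Z)`" for test families; `K ⊆ ℂ` normal containing the coordinates).
[cite: NguyenRoy2016, Proposition 15 and its proof; Roy2013, Propositions 2.3, 2.4, 6.1, 6.2] -/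
theorem step2_family_normalised_le {ξ η r s : ℂ} (hr : r ≠ 0) (hη : η ≠ 0) (hs : 1 < ‖s‖)
    {T Li : ℕ} (hTL : T ≤ (Li + 2).choose 2) (hLD : Li ≤ D) {Y U : ℝ} (hU : 0 ≤ U)
    (hY : interpConst ξ η r s Li ≤ Real.exp Y)
    (hPmem : map (Int.castRingHom ℂ) Pt ∈ nrBody D ξ η r s Y U T)
    (hQmem : map (Int.castRingHom ℂ) Qt ∈ nrBody D ξ η r s Y U T)
    {k : ℕ} (hk : D ^ 2 ≤ 2 ^ k) [Normal ℚ K] [NumberField K] (t : Fin L.m → CX)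
    (ht : ∀ i, t i ∈ nrBody D ξ η r s Y U T) :
    ∏ i, (‖eval (L.α i) (t i)‖ / ‖L.α i‖ ^ D) ^ L.e i ≤
      2 ^ (2 * k * 2 ^ k) * (Real.exp (-(T * U)) *
        ((Fintype.card (PhiRow D)).factorial * (3 * Real.exp Y) ^ Fintype.card (PhiRow D))) *
        Real.exp (-((∑ i, (L.e i : ℝ) * (D * logHeight ((L.cfg K hK).rep i))) /
          Module.finrank ℚ K)) := by
  -- abbreviations
  obtain ⟨S₀, hS₀⟩ : ∃ S₀ : ℝ, S₀ = 2 ^ (2 * k * 2 ^ k) * (Real.exp (-(T * U)) *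
      ((Fintype.card (PhiRow D)).factorial * (3 * Real.exp Y) ^ Fintype.card (PhiRow D))) :=
    ⟨_, rfl⟩
  obtain ⟨Hs, hHs⟩ : ∃ Hs : ℝ, Hs = ∑ i, (L.e i : ℝ) * (D * logHeight ((L.cfg K hK).rep i)) :=
    ⟨_, rfl⟩
  obtain ⟨A, hA⟩ : ∃ A : ℝ, A = ∏ i, ‖L.α i‖ ^ (D * L.e i) := ⟨_, rfl⟩
  rw [← hS₀, ← hHs]
  have hcore := L.step2_family_le hr hη hs hTL hLD hU hY hPmem hQmem hk t ht
  rw [← hS₀] at hcore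
  have hc : 0 < ‖L.c‖ := norm_pos_iff.mpr L.hc
  have hαpos : ∀ i, 0 < ‖L.α i‖ := fun i => norm_pos_iff.mpr (L.α_ne_zero i)
  have hA0 : 0 < A := by rw [hA]; exact prod_pos fun i _ => pow_pos (hαpos i) _
  have hn : (0 : ℝ) < Module.finrank ℚ K := by exact_mod_cast Module.finrank_pos
  -- the gain: `exp(Hs/n) ≤ ‖c‖ * A`
  have hgain := L.height_le_log_leading_sup K hK
  rw [← hHs] at hgain
  have hlogA : Real.log A = D * ∑ i, (L.e i : ℝ) * Real.log ‖L.α i‖ := by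
    rw [hA, Real.log_prod (s := univ) (fun i _ => (pow_pos (hαpos i) _).ne'), mul_sum]
    refine Finset.sum_congr rfl fun i _ => ?_
    rw [Real.log_pow, Nat.cast_mul]; ring
  have hexp : Real.exp (Hs / Module.finrank ℚ K) ≤ ‖L.c‖ * A := by
    have h1 : Hs / Module.finrank ℚ K ≤ Real.log ‖L.c‖ + Real.log A := by
      rw [div_le_iff₀ hn, hlogA]; linarith
    calc Real.exp (Hs / Module.finrank ℚ K) ≤ Real.exp (Real.log ‖L.c‖ + Real.log A) :=
          Real.exp_le_exp.mpr h1
      _ = ‖L.c‖ * A := by rw [Real.exp_add, Real.exp_log hc, Real.exp_log hA0]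
  -- rewrite the left-hand side
  have hL : ∏ i, (‖eval (L.α i) (t i)‖ / ‖L.α i‖ ^ D) ^ L.e i =
      (∏ i, ‖eval (L.α i) (t i)‖ ^ L.e i) / A := by
    rw [hA, ← prod_div_distrib]
    refine Finset.prod_congr rfl fun i _ => ?_
    rw [div_pow, ← pow_mul]
  rw [hL, div_le_iff₀ hA0]
  -- `∏ ≤ S₀/‖c‖` and `S₀/‖c‖ ≤ S₀ exp(-Hs/n) A`
  have h1 : ∏ i, ‖eval (L.α i) (t i)‖ ^ L.e i ≤ S₀ / ‖L.c‖ := by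
    rw [le_div_iff₀ hc, mul_comm]; exact hcore
  have hS₀0 : 0 ≤ S₀ := by rw [hS₀]; positivity
  have h2 : S₀ / ‖L.c‖ ≤ S₀ * Real.exp (-(Hs / Module.finrank ℚ K)) * A := by
    rw [Real.exp_neg, div_le_iff₀ hc]
    have h3 : S₀ * (Real.exp (Hs / Module.finrank ℚ K))⁻¹ * A * ‖L.c‖ =
        S₀ * ((‖L.c‖ * A) / Real.exp (Hs / Module.finrank ℚ K)) := by
      field_simp
    rw [h3]
    refine le_mul_of_one_le_right hS₀0 ?_
    rw [one_le_div (Real.exp_pos _)]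
    exact hexp
  exact h1.trans h2

end PairPkg

namespace PairPkg

variable {D : ℕ} {Pt Qt : MvPolynomial (Fin 3) ℤ} (L : PairPkg D Pt Qt)

/-! ### The representatives are `nv`-normalised -/

/-- The pivot of `αⱼ` (first non-zero coordinate) is `piv j`. [folklore] -/
theorem pivot_α (j : Fin L.m) : pivot (L.α j) = L.piv j := by
  have h1 : L.α j (L.piv j) ≠ 0 := by rw [L.piv_one]; exact one_ne_zero
  rcases pivot_cases (L.α j) with ⟨h, h0⟩ | ⟨h, h0, h1'⟩ | ⟨h, h0, h1'⟩
  · rw [h]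
    have := L.piv_min j 0 h0
    exact (Fin.le_zero_iff.mp this).symm
  · rw [h]
    have hle : L.piv j ≤ 1 := L.piv_min j 1 h1'
    have hne : L.piv j ≠ 0 := fun h' => h1 (by rw [h']; exact h0)
    omega
  · rw [h]
    have hne0 : L.piv j ≠ 0 := fun h' => h1 (by rw [h']; exact h0)
    have hne1 : L.piv j ≠ 1 := fun h' => h1 (by rw [h']; exact h1')
    omega

/-- `nrm αⱼ = αⱼ`. [folklore] -/
theorem nrm_α (j : Fin L.m) : nrm (L.α j) = L.α j := by
  funext k
  rw [nrm, pivot_α, L.piv_one, div_one]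

/-- **`nv [αⱼ] = αⱼ`**: the normalised coordinates of the point `[αⱼ]` are `αⱼ`. [folklore] -/
theorem nv_pt (j : Fin L.m) : nv (L.pt j) = L.α j := by
  rw [pt, (nv_mk (L.α_ne_zero j)).1, nrm_α]

/-- `ℚ([αⱼ]) = ℚ(coordinates of αⱼ) ⊆ K` for any field `K` containing the coordinates. [folklore] -/
theorem Kp_pt_le (K : IntermediateField ℚ ℂ) (hK : ∀ i k, L.α i k ∈ K) (j : Fin L.m) :
    Kp (L.pt j) ≤ K := by
  rw [Kp, nv_pt]
  refine IntermediateField.adjoin_le_iff.mpr ?_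
  rintro x ⟨k, rfl⟩
  exact hK j k

/-- The coordinates of `ap [αⱼ]` pushed into `K` are `rep j`. [folklore] -/
theorem inclusion_ap_pt (K : IntermediateField ℚ ℂ) (hK : ∀ i k, L.α i k ∈ K) (j : Fin L.m)
    (k : Fin 3) :
    IntermediateField.inclusion (L.Kp_pt_le K hK j) (ap (L.pt j) k) = (L.cfg K hK).rep j k := by
  apply Subtype.ext
  change ((ap (L.pt j) k : Kp (L.pt j)) : ℂ) = L.α j k
  rw [coe_ap, nv_pt]

/-! ### The points of `W` are algebraic -/

/-- The presentation `(K, ⊆, rep j)` of the point `[αⱼ]` over a number field `K ⊆ ℂ` containing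
the coordinates. [cite: NguyenRoy2016, §4] -/
def presPt (K : IntermediateField ℚ ℂ) (hK : ∀ i k, L.α i k ∈ K) [NumberField K] (j : Fin L.m) :
    NFPres (L.pt j) where
  K := K
  ι := (algebraMap K ℂ : K →+* ℂ)
  a := (L.cfg K hK).rep j
  ne_zero := L.α_ne_zero j
  mk_eq := rfl

/-- **The points of `W = 𝒵(P̃, Q̃)` are algebraic.** [cite: NguyenRoy2016, §5, proof of
Proposition 14 ("it is a finite union of `ℚ`-subvarieties")] -/
theorem isAlgPt_pt (j : Fin L.m) : IsAlgPt (L.pt j) :=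
  ⟨L.presPt (closureField L.coords) L.mem_closureField_coords j⟩

/-- The point `[αⱼ]` as an algebraic point. [cite: NguyenRoy2016, §4] -/
def algPt (j : Fin L.m) : AlgPt := ⟨L.pt j, L.isAlgPt_pt j⟩

/-- Its underlying point. [folklore] -/
@[simp] theorem algPt_val (j : Fin L.m) : (L.algPt j).1 = L.pt j := rfl

/-! ### Conjugates versus embeddings of `K` -/

section conj

variable (K : IntermediateField ℚ ℂ) (hK : ∀ i k, L.α i k ∈ K)

/-- `σ(rep j) ≠ 0` for an embedding `σ`. [folklore] -/
theorem map_rep_ne_zero (σ : K →ₐ[ℚ] ℂ) (j : Fin L.m) :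
    (fun k => σ ((L.cfg K hK).rep j k)) ≠ 0 := fun h => by
  have h1 := congrFun h (L.piv j)
  have h2 : (L.cfg K hK).rep j (L.piv j) = 1 := Subtype.ext (L.piv_one j)
  rw [h2, map_one] at h1
  exact one_ne_zero h1

/-- `g(rep j) ≠ 0` in `ℂ³` for `g ∈ Aut(K/ℚ)` (`img g j ≠ 0`). [folklore] -/
theorem img_ne_zero [Normal ℚ K] (g : K ≃ₐ[ℚ] K) (j : Fin L.m) : (L.cfg K hK).img g j ≠ 0 := by
  rw [(L.cfg K hK).img_eq g j]
  exact (L.cfg K hK).α_ne_zero _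

variable [NumberField K]

/-- **`conj [αⱼ] = {[σ(rep j)] : σ : K →ₐ[ℚ] ℂ}`**: the conjugates of a point of `W` are obtained
from the embeddings of any number field `K ⊆ ℂ` containing its coordinates (every embedding of
`ℚ([αⱼ])` extends to `K`). [cite: NguyenRoy2016, §4 ("`σᵢ(α̲)` are representatives of the `n` points of `Z`")] -/
theorem conj_algPt_eq_image (j : Fin L.m) :
    (L.algPt j).conj = (univ : Finset (K →ₐ[ℚ] ℂ)).image fun σ =>
      Projectivization.mk ℂ (fun k => σ ((L.cfg K hK).rep j k)) (L.map_rep_ne_zero K hK σ j) := by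
  have hle : Kp (L.pt j) ≤ K := L.Kp_pt_le K hK j
  -- the tower `ℚ ⊆ ℚ([αⱼ]) ⊆ K`
  letI : Algebra (Kp (L.pt j)) K := (IntermediateField.inclusion hle).toRingHom.toAlgebra
  haveI : IsScalarTower ℚ (Kp (L.pt j)) K := IsScalarTower.of_algebraMap_eq fun _ => rfl
  haveI : Algebra.IsAlgebraic ℚ K := Algebra.IsAlgebraic.of_finite ℚ K
  haveI : Algebra.IsAlgebraic (Kp (L.pt j)) K := Algebra.IsAlgebraic.tower_top (K := ℚ) _
  have hsurj := IsAlgClosed.surjective_restrictDomain_of_isAlgebraic (K := ℚ) (L := Kp (L.pt j))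
    (M := ℂ) (E := K)
  -- the two parametrisations give the same points
  have hpt : ∀ σ : K →ₐ[ℚ] ℂ, (L.algPt j).embPt (σ.restrictDomain (Kp (L.pt j))) =
      Projectivization.mk ℂ (fun k => σ ((L.cfg K hK).rep j k)) (L.map_rep_ne_zero K hK σ j) := by
    intro σ
    apply mk_congr
    funext k
    change σ (algebraMap (Kp (L.pt j)) K (ap (L.pt j) k)) = σ ((L.cfg K hK).rep j k)
    congr 1
    exact L.inclusion_ap_pt K hK j k
  ext q
  simp only [AlgPt.conj, mem_image, mem_univ, true_and]
  constructor
  · rintro ⟨φ, rfl⟩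
    obtain ⟨σ, hσ⟩ := hsurj φ
    refine ⟨σ, ?_⟩
    rw [← hpt σ]
    exact congrArg _ hσ
  · rintro ⟨σ, rfl⟩
    exact ⟨σ.restrictDomain (Kp (L.pt j)), hpt σ⟩

variable [Normal ℚ K]

omit [NumberField K] in
/-- `[α_{perm g j}] = [g(rep j)]`: the permutation of the representatives by `g ∈ Aut(K/ℚ)` is
conjugation of the points. [folklore] -/
theorem pt_perm (g : K ≃ₐ[ℚ] K) (j : Fin L.m) :
    L.pt ((L.cfg K hK).perm g j) =
      Projectivization.mk ℂ ((L.cfg K hK).img g j) (L.img_ne_zero K hK g j) := by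
  apply mk_congr
  have h := (L.cfg K hK).img_eq g j
  rw [cfg_α] at h
  exact h.symm

/-- **The Galois orbit of `j₀` is the conjugate set of `[α_{j₀}]`:** `{[αᵢ] : i ∈ orb j₀} =
conj [α_{j₀}]`. [cite: NguyenRoy2016, §4 ("`σᵢ(α̲)` are representatives of the `n` points of `Z`")] -/
theorem image_orb_pt_eq_conj (j₀ : Fin L.m) :
    ((L.cfg K hK).orb j₀).image L.pt = (L.algPt j₀).conj := by
  rw [L.conj_algPt_eq_image K hK j₀]
  ext q
  simp only [mem_image, ZeroConfigK.orb, mem_filter, mem_univ, true_and]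
  constructor
  · rintro ⟨j, ⟨g, rfl⟩, rfl⟩
    refine ⟨(K.val : K →ₐ[ℚ] ℂ).comp (g : K →ₐ[ℚ] K), ?_⟩
    rw [L.pt_perm K hK]
    exact mk_congr _ _ (funext fun k => rfl)
  · rintro ⟨σ, rfl⟩
    refine ⟨(L.cfg K hK).perm (ZeroConfigK.autOfEmb σ.toRingHom) j₀, ⟨_, rfl⟩, ?_⟩
    rw [L.pt_perm K hK]
    apply mk_congr
    funext k
    exact ZeroConfigK.coe_autOfEmb σ.toRingHom _

/-- **`#orb j₀ = deg [α_{j₀}]`.** [cite: NguyenRoy2016, §4 (`deg Z = [ℚ(α̲):ℚ]` = number of points)] -/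
theorem card_orb_eq_deg (j₀ : Fin L.m) : ((L.cfg K hK).orb j₀).card = (L.algPt j₀).deg := by
  rw [← AlgPt.card_conj, ← L.image_orb_pt_eq_conj K hK j₀,
    card_image_of_injective _ L.pt_injective]

/-- **`∑_{i ∈ orb j₀} h_abs([αᵢ]) = ht [α_{j₀}]`** (`= deg · h_abs`, the height of the endgame).
[cite: NguyenRoy2016, §4 (`|h(Z)/n − h_abs(α̲)| ≤ 3`; here `ht := deg · h_abs`)] -/
theorem sum_orb_habs_eq_ht (j₀ : Fin L.m) :
    ∑ i ∈ (L.cfg K hK).orb j₀, habs (L.pt i) = (L.algPt j₀).ht := by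
  rw [AlgPt.ht, ← AlgPt.card_conj, ← L.image_orb_pt_eq_conj K hK j₀,
    ← sum_image fun i _ j _ h => L.pt_injective h]
  rw [sum_congr rfl fun q hq => AlgPt.habs_of_mem_conj (L.algPt j₀)
    (by rw [← L.image_orb_pt_eq_conj K hK j₀]; exact hq), sum_const, nsmul_eq_mul]

/-- The same with the heights of the `K`-representatives:
`(∑_{i ∈ orb j₀} h_K(rep i))/[K:ℚ] = ht [α_{j₀}]`. [cite: NguyenRoy2016, §4] -/
theorem sum_orb_logHeight_div_eq_ht (j₀ : Fin L.m) :
    (∑ i ∈ (L.cfg K hK).orb j₀, logHeight ((L.cfg K hK).rep i)) / finrank ℚ K =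
      (L.algPt j₀).ht := by
  rw [← L.sum_orb_habs_eq_ht K hK j₀, sum_div]
  exact sum_congr rfl fun i _ => (L.habs_pt K hK i).symm

end conj

end PairPkg

namespace PairPkg

variable {D : ℕ} {Pt Qt : MvPolynomial (Fin 3) ℤ} (L : PairPkg D Pt Qt) (K : IntermediateField ℚ ℂ)
  (hK : ∀ i k, L.α i k ∈ K)

/-! ### Multiplicities and weights of orbits -/

/-- The multiplicity of an orbit (the common value of `eⱼ` on it). [cite: Roy2013, §6, proof of
Prop. 6.4 ("`e₁ = ⋯ = e_s` represents the multiplicity")] -/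
def eO (O : Finset (Fin L.m)) : ℕ := O.sup L.e

/-- The weight `w_O = Y' #O + D ∑_{j∈O} h_abs([αⱼ])` (`= Y' deg Z + D ht Z` for the orbit of `Z`).
[cite: NguyenRoy2016, Proposition 15 (`Y deg(Z_D) + D h(Z_D)`)] -/
def wO (Yw : ℝ) (O : Finset (Fin L.m)) : ℝ := Yw * O.card + D * ∑ j ∈ O, habs (L.pt j)

variable [NumberField K]

/-- `e` is constant on orbits. [cite: Roy2013, §6, proof of Prop. 6.4 ("`e₁ = ⋯ = e_s`")] -/
theorem e_eq_of_mem_orb {j i : Fin L.m} (hi : i ∈ (L.cfg K hK).orb j) : L.e i = L.e j := by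
  obtain ⟨-, g, rfl⟩ := mem_filter.mp hi
  exact mult_perm (L.cfg K hK) (L.map_intF_eq_prod_cfg K hK) (L.hemax_cfg K hK) g j

/-- `eO (orb j) = e j`. [folklore] -/
theorem eO_orb (j : Fin L.m) : L.eO ((L.cfg K hK).orb j) = L.e j := by
  refine le_antisymm (Finset.sup_le fun i hi => (L.e_eq_of_mem_orb K hK hi).le) ?_
  exact Finset.le_sup (f := L.e) ((L.cfg K hK).self_mem_orb j)

/-- **`∑_O e_O w_O = Y' ∑ⱼ eⱼ + D ∑ⱼ eⱼ h_abs([αⱼ]) = Y'D² + D ∑ⱼ eⱼ h_abs([αⱼ])`** (the orbits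
partition the points). [cite: Roy2013, §6, proof of Prop. 6.2 (`∑ mᵢ deg Zᵢ = D deg W`, `∑ mᵢ h(Zᵢ) = h(W)`)] -/
theorem sum_eO_mul_wO (Yw : ℝ) :
    ∑ O ∈ univ.image (L.cfg K hK).orb, (L.eO O : ℝ) * L.wO Yw O =
      Yw * (D : ℝ) ^ 2 + D * ∑ j, (L.e j : ℝ) * habs (L.pt j) := by
  have h := Finset.sum_image' (s := univ) (g := (L.cfg K hK).orb)
    (f := fun O => (L.eO O : ℝ) * L.wO Yw O)
    (h := fun j => (L.e j : ℝ) * (Yw + D * habs (L.pt j))) (fun j _ => ?_)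
  · rw [h, ← Nat.cast_pow, ← L.hcard, ← L.hesum]
    push_cast
    rw [mul_sum, mul_sum, ← sum_add_distrib]
    refine sum_congr rfl fun j _ => ?_
    ring
  · -- the fibre of `orb` over `orb j` is `orb j`
    have hfib : univ.filter (fun i => (L.cfg K hK).orb i = (L.cfg K hK).orb j) =
        (L.cfg K hK).orb j := by
      ext i
      simp only [mem_filter, mem_univ, true_and]
      constructor
      · intro h; rw [← h]; exact (L.cfg K hK).self_mem_orb i
      · intro h; exact (L.cfg K hK).orb_eq_of_mem h
    rw [hfib, eO_orb, wO, mul_add, mul_sum, mul_sum]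
    rw [show (L.e j : ℝ) * (Yw * ((L.cfg K hK).orb j).card) =
      ∑ i ∈ (L.cfg K hK).orb j, (L.e j : ℝ) * Yw by rw [sum_const, nsmul_eq_mul]; ring]
    rw [← sum_add_distrib]
    refine sum_congr rfl fun i hi => ?_
    rw [L.e_eq_of_mem_orb K hK hi]
    ring

/-- **`D ∑ⱼ eⱼ h_abs([αⱼ]) ≤ log 𝓛(F₀)`** (the height of `W` with multiplicities).
[cite: NguyenRoy2016, proof of Proposition 14 (`h(W) ≤ …`); Roy2013, Prop. 2.2 (ii)] -/
theorem mul_sum_e_habs_le (hK : ∀ i k, L.α i k ∈ K) :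
    (D : ℝ) * ∑ j, (L.e j : ℝ) * habs (L.pt j) ≤
      Real.log (∑ n ∈ L.intF.support, |((coeff n L.intF : ℤ) : ℝ)|) := by
  have h := L.sum_e_mul_height_le K hK
  have hn : (0 : ℝ) < finrank ℚ K := Nat.cast_pos.mpr finrank_pos
  have heq : (D : ℝ) * ∑ j, (L.e j : ℝ) * habs (L.pt j) =
      (∑ j, (L.e j : ℝ) * (D * logHeight ((L.cfg K hK).rep j))) / finrank ℚ K := by
    rw [mul_sum, sum_div]
    refine sum_congr rfl fun j _ => ?_
    rw [L.habs_pt K hK j]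
    ring
  rw [heq, div_le_iff₀ hn, mul_comm]
  exact h

/-- `∑ⱼ eⱼ D h_abs([αⱼ]) = (∑ⱼ eⱼ D h_K(rep j))/[K:ℚ]`. [folklore] -/
theorem sum_e_habs_eq :
    ∑ j, (L.e j : ℝ) * (D * habs (L.pt j)) =
      (∑ j, (L.e j : ℝ) * (D * logHeight ((L.cfg K hK).rep j))) / finrank ℚ K := by
  rw [sum_div]
  refine sum_congr rfl fun j _ => ?_
  rw [L.habs_pt K hK j]
  ring

/-! ### The selection -/

/-- **Proposition 15 (selection of `Z_D`), orbit form.** Under the hypotheses of Step 2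
(`P̃, Q̃ ∈ 𝒞`, …) and `S₀ = 2^{2k2^k}e^{−TU}N!(3e^Y)^N < 1`, `Y' > 0`, `D ≥ 1`: there is an orbit
`O = orb j₀` such that for every family `Rⱼ ∈ 𝒞`, `j ∈ O`,
`∏_{j∈O} (|Rⱼ(αⱼ)|/‖αⱼ‖^D) e^{D h_abs([αⱼ])} ≤ S₀^{w_O/B}`, `B = Y'D² + D∑ⱼ eⱼ h_abs([αⱼ])`.
[cite: NguyenRoy2016, Proposition 15 and its proof; Roy2013, §6, proofs of Props. 6.2 and 6.4] -/
theorem exists_orb_prod_le [Normal ℚ K] (hD : 1 ≤ D) {ξ η r s : ℂ} (hr : r ≠ 0) (hη : η ≠ 0) (hs : 1 < ‖s‖)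
    {T Li : ℕ} (hTL : T ≤ (Li + 2).choose 2) (hLD : Li ≤ D) {Y U : ℝ} (hU : 0 ≤ U)
    (hY : interpConst ξ η r s Li ≤ Real.exp Y)
    (hPmem : map (Int.castRingHom ℂ) Pt ∈ nrBody D ξ η r s Y U T)
    (hQmem : map (Int.castRingHom ℂ) Qt ∈ nrBody D ξ η r s Y U T)
    {k : ℕ} (hk : D ^ 2 ≤ 2 ^ k)
    (hS : 2 ^ (2 * k * 2 ^ k) * (Real.exp (-(T * U)) *
        ((Fintype.card (PhiRow D)).factorial * (3 * Real.exp Y) ^ Fintype.card (PhiRow D))) < 1)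
    {Yw : ℝ} (hYw : 0 < Yw) :
    ∃ j₀ : Fin L.m, ∀ t : Fin L.m → CX, (∀ j ∈ (L.cfg K hK).orb j₀, t j ∈ nrBody D ξ η r s Y U T) →
      ∏ j ∈ (L.cfg K hK).orb j₀,
          ‖eval (L.α j) (t j)‖ / ‖L.α j‖ ^ D * Real.exp (D * habs (L.pt j)) ≤
        (2 ^ (2 * k * 2 ^ k) * (Real.exp (-(T * U)) *
          ((Fintype.card (PhiRow D)).factorial * (3 * Real.exp Y) ^ Fintype.card (PhiRow D)))) ^
          (L.wO Yw ((L.cfg K hK).orb j₀) / (Yw * (D : ℝ) ^ 2 + D * ∑ j, (L.e j : ℝ) * habs (L.pt j))) := by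
  set S₀ : ℝ := 2 ^ (2 * k * 2 ^ k) * (Real.exp (-(T * U)) *
    ((Fintype.card (PhiRow D)).factorial * (3 * Real.exp Y) ^ Fintype.card (PhiRow D))) with hS₀
  set Bv : ℝ := Yw * (D : ℝ) ^ 2 + D * ∑ j, (L.e j : ℝ) * habs (L.pt j) with hBv
  have hS0 : 0 < S₀ := by rw [hS₀]; positivity
  have hBv0 : 0 < Bv := by
    have h1 : (1 : ℝ) ≤ (D : ℝ) ^ 2 := by
      have : (1 : ℝ) ≤ D := by exact_mod_cast hD
      nlinarith
    have h2 : 0 ≤ (D : ℝ) * ∑ j, (L.e j : ℝ) * habs (L.pt j) :=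
      mul_nonneg (Nat.cast_nonneg _) (sum_nonneg fun j _ => mul_nonneg (Nat.cast_nonneg _)
        (habs_nonneg _))
    rw [hBv]; nlinarith
  -- the test values `v_j(R) = (|R(α_j)|/‖α_j‖^D) e^{D h_abs([α_j])}`
  have H : ∀ t : Fin L.m → CX, (∀ j, t j ∈ nrBody D ξ η r s Y U T) →
      ∏ j, (‖eval (L.α j) (t j)‖ / ‖L.α j‖ ^ D * Real.exp (D * habs (L.pt j))) ^ L.e j ≤ S₀ := by
    intro t ht
    have h := L.step2_family_normalised_le K hK hr hη hs hTL hLD hU hY hPmem hQmem hk t ht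
    rw [← hS₀, ← L.sum_e_habs_eq K hK] at h
    have hexp : ∏ j, Real.exp (D * habs (L.pt j)) ^ L.e j =
        Real.exp (∑ j, (L.e j : ℝ) * (D * habs (L.pt j))) := by
      rw [Real.exp_sum]
      refine prod_congr rfl fun j _ => ?_
      rw [← Real.exp_nat_mul]
    have hpos : 0 < Real.exp (∑ j, (L.e j : ℝ) * (D * habs (L.pt j))) := Real.exp_pos _
    calc ∏ j, (‖eval (L.α j) (t j)‖ / ‖L.α j‖ ^ D * Real.exp (D * habs (L.pt j))) ^ L.e j
        = (∏ j, (‖eval (L.α j) (t j)‖ / ‖L.α j‖ ^ D) ^ L.e j) *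
            Real.exp (∑ j, (L.e j : ℝ) * (D * habs (L.pt j))) := by
          rw [← hexp, ← prod_mul_distrib]
          refine prod_congr rfl fun j _ => ?_
          rw [mul_pow]
      _ ≤ S₀ * Real.exp (-(∑ j, (L.e j : ℝ) * (D * habs (L.pt j)))) *
            Real.exp (∑ j, (L.e j : ℝ) * (D * habs (L.pt j))) :=
          mul_le_mul_of_nonneg_right h hpos.le
      _ = S₀ := by rw [mul_assoc, ← Real.exp_add, neg_add_cancel, Real.exp_zero, mul_one]
  -- the selection
  have hsum : ∑ O ∈ univ.image (L.cfg K hK).orb, (L.eO O : ℝ) * L.wO Yw O ≤ Bv := by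
    rw [L.sum_eO_mul_wO K hK Yw]
  obtain ⟨j₀, hj₀⟩ := (L.cfg K hK).exists_orb_forall_prod_le L.e L.eO (L.eO_orb K hK) L.he1
    (L.wO Yw) (fun R : CX => R ∈ nrBody D ξ η r s Y U T)
    (fun j R => ‖eval (L.α j) R‖ / ‖L.α j‖ ^ D * Real.exp (D * habs (L.pt j))) hS0 hS hBv0 hsum H
  exact ⟨j₀, hj₀⟩

/-! ### The subvariety `Z_D` -/

/-- **Proposition 15 with [R2012, Prop. 2.3] (selection of `Z_D`), conjugate-set form.** Under
the hypotheses of `exists_orb_prod_le` there is an algebraic point `Z_D = [α_{j₀}]` of `W` with: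
for every family `Rⱼ ∈ 𝒞` indexed by the orbit `O = orb j₀` (whose points are `conj Z_D`),
`∏_{j∈O} |Rⱼ(αⱼ)|/‖αⱼ‖^D ≤ S₀^{(Y' deg Z_D + D ht Z_D)/B} · e^{−D ht Z_D}`,
`B = Y'D² + D∑ⱼ eⱼ h_abs([αⱼ])`. [cite: NguyenRoy2016, Proposition 15; Corollary 16 (proof, first display)] -/
theorem exists_orb_prod_le' [Normal ℚ K] (hD : 1 ≤ D) {ξ η r s : ℂ} (hr : r ≠ 0) (hη : η ≠ 0) (hs : 1 < ‖s‖)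
    {T Li : ℕ} (hTL : T ≤ (Li + 2).choose 2) (hLD : Li ≤ D) {Y U : ℝ} (hU : 0 ≤ U)
    (hY : interpConst ξ η r s Li ≤ Real.exp Y)
    (hPmem : map (Int.castRingHom ℂ) Pt ∈ nrBody D ξ η r s Y U T)
    (hQmem : map (Int.castRingHom ℂ) Qt ∈ nrBody D ξ η r s Y U T)
    {k : ℕ} (hk : D ^ 2 ≤ 2 ^ k)
    (hS : 2 ^ (2 * k * 2 ^ k) * (Real.exp (-(T * U)) *
        ((Fintype.card (PhiRow D)).factorial * (3 * Real.exp Y) ^ Fintype.card (PhiRow D))) < 1)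
    {Yw : ℝ} (hYw : 0 < Yw) :
    ∃ j₀ : Fin L.m, ∀ t : Fin L.m → CX, (∀ j ∈ (L.cfg K hK).orb j₀, t j ∈ nrBody D ξ η r s Y U T) →
      ∏ j ∈ (L.cfg K hK).orb j₀, ‖eval (L.α j) (t j)‖ / ‖L.α j‖ ^ D ≤
        (2 ^ (2 * k * 2 ^ k) * (Real.exp (-(T * U)) *
          ((Fintype.card (PhiRow D)).factorial * (3 * Real.exp Y) ^ Fintype.card (PhiRow D)))) ^
          ((Yw * (L.algPt j₀).deg + D * (L.algPt j₀).ht) /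
            (Yw * (D : ℝ) ^ 2 + D * ∑ j, (L.e j : ℝ) * habs (L.pt j))) *
        Real.exp (-(D * (L.algPt j₀).ht)) := by
  obtain ⟨j₀, hj₀⟩ := L.exists_orb_prod_le K hK hD hr hη hs hTL hLD hU hY hPmem hQmem hk hS hYw
  refine ⟨j₀, fun t ht => ?_⟩
  have h := hj₀ t ht
  have hw : L.wO Yw ((L.cfg K hK).orb j₀) = Yw * (L.algPt j₀).deg + D * (L.algPt j₀).ht := by
    rw [wO, L.card_orb_eq_deg K hK, L.sum_orb_habs_eq_ht K hK]
  rw [hw] at h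
  have hexp : ∏ j ∈ (L.cfg K hK).orb j₀, Real.exp (D * habs (L.pt j)) =
      Real.exp (D * (L.algPt j₀).ht) := by
    rw [← L.sum_orb_habs_eq_ht K hK, mul_sum, Real.exp_sum]
  have hpos : 0 < Real.exp (D * (L.algPt j₀).ht) := Real.exp_pos _
  rw [prod_mul_distrib, hexp] at h
  have hE : Real.exp (-(D * (L.algPt j₀).ht)) = (Real.exp (D * (L.algPt j₀).ht))⁻¹ :=
    Real.exp_neg _
  rw [hE, ← div_eq_mul_inv, le_div_iff₀ hpos]
  exact h

/-! ### `Z_D ⊆ W_D`: integer forms in `𝒞` vanish on the selected orbit -/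

/-- **Integer forms of degree `D` in `𝒞` vanish on the selected orbit** ([R2012, Prop. 2.4] ⇒
`Z_D ⊆ 𝒵(𝒞 ∩ ℤ[X]_D)`, in particular `Z_D ⊆ W_D`): if on the orbit `O = orb j₀` every admissible
family satisfies `∏_{j∈O} (|Rⱼ(αⱼ)|/‖αⱼ‖^D) e^{D h_abs([αⱼ])} ≤ S₀^{w/B}` with `0 < S₀ < 1`, `w > 0`,
`B > 0`, then every `R ∈ ℤ[X]_D` with `R ⊗ ℂ ∈ 𝒞` vanishes at `αⱼ` for all `j ∈ O`.
[cite: NguyenRoy2016, Proposition 15 ("`Z_D` … contained in `W_D`"); Roy2013, Proposition 2.4 and §6, proof of Prop. 6.4] -/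
theorem eval_eq_zero_of_orbit_bound [Normal ℚ K] (j₀ : Fin L.m) (body : Set CX) {S₀ w B : ℝ} (hS0 : 0 < S₀)
    (hS1 : S₀ < 1) (hw : 0 < w) (hB : 0 < B)
    (hO : ∀ t : Fin L.m → CX, (∀ j ∈ (L.cfg K hK).orb j₀, t j ∈ body) →
      ∏ j ∈ (L.cfg K hK).orb j₀,
          ‖eval (L.α j) (t j)‖ / ‖L.α j‖ ^ D * Real.exp (D * habs (L.pt j)) ≤ S₀ ^ (w / B))
    {R : MvPolynomial (Fin 3) ℤ} (hR : R.IsHomogeneous D) (hmem : map (Int.castRingHom ℂ) R ∈ body) :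
    ∀ j ∈ (L.cfg K hK).orb j₀, eval (L.α j) (map (Int.castRingHom ℂ) R) = 0 := by
  set Z := L.cfg K hK with hZ
  -- admissible := in the body and non-vanishing on the orbit
  set ok : CX → Prop := fun R' => R' ∈ body ∧ ∀ j ∈ Z.orb j₀, eval (L.α j) R' ≠ 0 with hok
  set X : ℝ := -(w / B * Real.log S₀) + D * ∑ j ∈ Z.orb j₀, habs (L.pt j) with hX
  have hlogS : Real.log S₀ < 0 := Real.log_neg hS0 hS1
  have hmargin : 0 < -(w / B * Real.log S₀) := by
    have : w / B * Real.log S₀ < 0 := mul_neg_of_pos_of_neg (div_pos hw hB) hlogS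
    linarith
  -- the orbit bound in logarithmic form, for admissible (non-vanishing) forms
  have hO' : ∀ R' : CX, ok R' →
      ∑ j ∈ Z.orb j₀, Real.log (‖aeval (Z.α j) R'‖ / ‖Z.α j‖ ^ D) ≤ -X := by
    intro R' hR'
    have h := hO (fun _ => R') fun j _ => hR'.1
    have hpos : ∀ j ∈ Z.orb j₀,
        0 < ‖eval (L.α j) R'‖ / ‖L.α j‖ ^ D * Real.exp (D * habs (L.pt j)) := fun j hj =>
      mul_pos (div_pos (norm_pos_iff.mpr (hR'.2 j hj)) (pow_pos (norm_pos_iff.mpr (L.α_ne_zero j)) _))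
        (Real.exp_pos _)
    have hlog := Real.log_le_log (prod_pos hpos) h
    rw [Real.log_prod (s := Z.orb j₀) (fun j hj => (hpos j hj).ne'), Real.log_rpow hS0] at hlog
    have hsplit : ∑ j ∈ Z.orb j₀, Real.log (‖eval (L.α j) R'‖ / ‖L.α j‖ ^ D *
        Real.exp (D * habs (L.pt j))) =
        ∑ j ∈ Z.orb j₀, Real.log (‖aeval (Z.α j) R'‖ / ‖Z.α j‖ ^ D) +
          D * ∑ j ∈ Z.orb j₀, habs (L.pt j) := by
      rw [mul_sum, ← sum_add_distrib]
      refine sum_congr rfl fun j hj => ?_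
      rw [Real.log_mul (div_pos (norm_pos_iff.mpr (hR'.2 j hj))
        (pow_pos (norm_pos_iff.mpr (L.α_ne_zero j)) _)).ne' (Real.exp_pos _).ne', Real.log_exp]
      rfl
    rw [hsplit] at hlog
    rw [hX]
    linarith
  have hXgt : (D : ℝ) * ((∑ j ∈ Z.orb j₀, logHeight (Z.rep j)) / Module.finrank ℚ K) < X := by
    have heq : (D : ℝ) * ((∑ j ∈ Z.orb j₀, logHeight (Z.rep j)) / Module.finrank ℚ K) =
        D * ∑ j ∈ Z.orb j₀, habs (L.pt j) := by
      rw [sum_div]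
      congr 1
      exact sum_congr rfl fun j _ => (L.habs_pt K hK j).symm
    rw [heq, hX]
    linarith
  -- values at the complex points versus values at the `K`-representatives
  have key : ∀ i, eval (L.α i) (map (Int.castRingHom ℂ) R) = ((aeval (Z.rep i) R : K) : ℂ) := by
    intro i
    rw [Z.coe_aeval_rep_int i R]
    change aeval (Z.α i) (map (Int.castRingHom ℂ) R) = aeval (Z.α i) R
    rw [← algebraMap_int_eq, aeval_map_algebraMap]
  -- by contradiction: a non-vanishing point makes `R` admissible, hence vanishing everywhere
  intro j hj
  by_contra hne
  have hnej : aeval (Z.rep j) R ≠ 0 := fun h0 => hne (by rw [key j, h0]; rfl)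
  -- `j₀ ∈ orb j`, so non-vanishing at `j` propagates to `j₀`, then to the whole orbit
  have hj₀ : j₀ ∈ Z.orb j := by rw [Z.orb_eq_of_mem hj]; exact Z.self_mem_orb j₀
  have hne0 : aeval (Z.rep j₀) R ≠ 0 := Z.aeval_rep_ne_zero_of_mem_orb hj₀ hnej
  have hall : ∀ i ∈ Z.orb j₀, eval (L.α i) (map (Int.castRingHom ℂ) R) ≠ 0 := by
    intro i hi h0
    refine Z.aeval_rep_ne_zero_of_mem_orb hi hne0 (Subtype.ext ?_)
    rw [← key i, h0]
    rfl
  have hvan := Z.aeval_eq_zero_of_orbit_bound j₀ ok hO' hXgt hR ⟨hmem, hall⟩ j hj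
  exact hne hvan

/-- The same on the conjugate set of `Z_D = [α_{j₀}]`: integer forms of degree `D` in the body
vanish at (the representative of) every point of `conj Z_D`. [cite: NguyenRoy2016, Proposition 15 ("`Z_D` … contained in `W_D`")] -/
theorem eval_rep_eq_zero_of_orbit_bound [Normal ℚ K] (j₀ : Fin L.m) (body : Set CX) {S₀ w B : ℝ} (hS0 : 0 < S₀)
    (hS1 : S₀ < 1) (hw : 0 < w) (hB : 0 < B)
    (hO : ∀ t : Fin L.m → CX, (∀ j ∈ (L.cfg K hK).orb j₀, t j ∈ body) →
      ∏ j ∈ (L.cfg K hK).orb j₀,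
          ‖eval (L.α j) (t j)‖ / ‖L.α j‖ ^ D * Real.exp (D * habs (L.pt j)) ≤ S₀ ^ (w / B))
    {R : MvPolynomial (Fin 3) ℤ} (hR : R.IsHomogeneous D) (hmem : map (Int.castRingHom ℂ) R ∈ body)
    {q : PPt} (hq : q ∈ (L.algPt j₀).conj) : eval q.rep (map (Int.castRingHom ℂ) R) = 0 := by
  rw [← L.image_orb_pt_eq_conj K hK j₀] at hq
  obtain ⟨j, hj, rfl⟩ := mem_image.mp hq
  rw [pt, eval_rep_mk_eq_zero_iff (hR.map (Int.castRingHom ℂ))]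
  exact L.eval_eq_zero_of_orbit_bound K hK j₀ body hS0 hS1 hw hB hO hR hmem j hj

end PairPkg

/-! ### The constant of Proposition 10 is positive -/

/-- `c₁₀(L) > 0` for `|s| > 1`. [folklore] -/
theorem c10_pos (ξ η r : ℂ) {s : ℂ} (hs : 1 < ‖s‖) (L : ℕ) : 0 < c10 ξ η r s L := by
  unfold c10
  have hmin : 0 < min 1 (‖s‖ - 1) := lt_min one_pos (by linarith)
  have hN : 0 < (((L + 1) * (L + 2) / 2 : ℕ) : ℝ) := by
    have h1 : 1 ≤ (L + 1) * (L + 2) / 2 := by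
      have : 2 ≤ (L + 1) * (L + 2) := by nlinarith
      omega
    exact_mod_cast h1
  have hs0 : 0 < ‖s‖ := by linarith
  have hA : 0 < 16 * (max 1 ‖η‖⁻¹ * (1 + ‖ξ‖) * max 1 ‖r‖⁻¹) * ‖s‖ * (min 1 (‖s‖ - 1))⁻¹ ^ 2 := by
    have h1 : 0 < max 1 ‖η‖⁻¹ := lt_max_of_lt_left one_pos
    have h2 : 0 < max 1 ‖r‖⁻¹ := lt_max_of_lt_left one_pos
    have h3 : 0 < 1 + ‖ξ‖ := by positivity
    positivity
  have hB : 0 < 1 + ‖ξ‖ + (((L + 1) * (L + 2) / 2 : ℕ) : ℝ) * ‖r‖ +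
      ‖η‖ * ‖s‖ ^ ((L + 1) * (L + 2) / 2) := by positivity
  positivity

/-! ### The test forms of the proof of Corollary 16 -/

/-- **A witness for the contrapositive of Proposition 10.** If `[v]` is at distance `≥ d > 0`
from each of `γ₀, …, γ_{T−1}` (`1 ≤ T ≤ binom(L+2,2)`, `L < D`, `|s| > 1`), then some form
`P ∈ I_D^{(T)}` (degree `D`, vanishing at `γ₀, …, γ_{T−1}`) has `|P(v)| > 𝓛(P) ‖v‖^D d/(2c₁₀)`.
[cite: NguyenRoy2016, Proposition 10; proof of Corollary 16 ("Proposition 10 gives `log dist(α, 𝒮) ≤ … + log|I_D^{(T)}|_α`")] -/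
theorem exists_test_of_pdist_pos {ξ η r s : ℂ} (hr : r ≠ 0) (hη : η ≠ 0) (hs : 1 < ‖s‖)
    {D T L : ℕ} (hT : 1 ≤ T) (hTM : T ≤ (L + 1) * (L + 2) / 2) (hLD : L < D) {v : V3} (hv : v ≠ 0)
    {d : ℝ} (hd : 0 < d)
    (hfar : ∀ i : ℕ, i < T → d ≤ pdist (Projectivization.mk ℂ v hv) (gamP ξ η r s i)) :
    ∃ P : CX, P.IsHomogeneous D ∧ (∀ i : ℕ, i < T → eval (gvec ξ η r s i) P = 0) ∧
      l1Norm P * ‖v‖ ^ D * (d / (2 * c10 ξ η r s L)) < ‖eval v P‖ := by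
  by_contra hcon
  push Not at hcon
  have hc := c10_pos ξ η r hs L
  have hε : 0 ≤ d / (2 * c10 ξ η r s L) := by positivity
  obtain ⟨i, hi, hle⟩ := exists_pdist_gamP_le hr hη hs hT hTM hLD hv hε hcon
  have h1 : c10 ξ η r s L * (d / (2 * c10 ξ η r s L)) = d / 2 := by
    field_simp
  rw [h1] at hle
  have h2 := hfar i hi
  linarith

/-- **`(e^Y/𝓛(P)) P ∈ 𝒞`** for a non-zero form of degree `D` vanishing at `γ₀, …, γ_{T−1}`
("for each `P ∈ I_D^{(T)}` with `‖P‖ = 1`, we have `e^{2D^β}P ∈ 𝒞_D`").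
[cite: NguyenRoy2016, proof of Corollary 16] -/
theorem smul_mem_nrBody {D : ℕ} {ξ η r s : ℂ} {Y U : ℝ} {T : ℕ} {P : CX} (hP : P.IsHomogeneous D)
    (hP0 : P ≠ 0) (hvan : ∀ i : ℕ, i < T → eval (gvec ξ η r s i) P = 0) :
    (((Real.exp Y / l1Norm P : ℝ) : ℂ)) • P ∈ nrBody D ξ η r s Y U T := by
  have hl : 0 < l1Norm P := l1Norm_pos_of_ne_zero hP0
  refine ⟨?_, ?_, fun i hi => ?_⟩
  · rw [smul_eq_C_mul]; exact hP.C_mul _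
  · rw [smul_eq_C_mul, maxNorm_C_mul, Complex.norm_real, Real.norm_eq_abs,
      abs_of_pos (div_pos (Real.exp_pos Y) hl)]
    calc Real.exp Y / l1Norm P * maxNorm P ≤ Real.exp Y / l1Norm P * l1Norm P :=
          mul_le_mul_of_nonneg_left (maxNorm_le_l1Norm P) (div_pos (Real.exp_pos Y) hl).le
      _ = Real.exp Y := div_mul_cancel₀ _ hl.ne'
  · rw [smul_eq_C_mul, map_mul, eval_C, ← gvec_natCast, hvan i hi, mul_zero, norm_zero]
    exact (Real.exp_pos _).le

/-! ### Corollary 16 from an orbit bound -/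

namespace PairPkg

variable {D : ℕ} {Pt Qt : MvPolynomial (Fin 3) ℤ} (L : PairPkg D Pt Qt) (K : IntermediateField ℚ ℂ)
  (hK : ∀ i k, L.α i k ∈ K) [NumberField K] [Normal ℚ K]

/-- **Corollary 16 (from the orbit bound of Proposition 15).** Let `O = orb j₀` be an orbit of the
points of `W` such that every family `Rⱼ ∈ 𝒞 = nrBody D ξ η r s Y U T`, `j ∈ O`, satisfies
`∏_{j∈O} |Rⱼ(αⱼ)|/‖αⱼ‖^D ≤ M`, and suppose the points of `conj Z_D` (`Z_D = [α_{j₀}]`) are at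
positive distance from `γ₀, …, γ_{T−1}` (`1 ≤ T ≤ binom(L+2, 2)`, `L < D`). Then, with `ι(q)` the
index of a closest `γᵢ` (`i < T`),
`∑_{q ∈ conj Z_D} (Y − log(2c₁₀(L)) + log dist(q, γ_{ι(q)})) ≤ log M`.
[cite: NguyenRoy2016, Corollary 16 and its proof] -/
theorem cor16_of_orbit_bound (j₀ : Fin L.m) {ξ η r s : ℂ} (hr : r ≠ 0) (hη : η ≠ 0)
    (hs : 1 < ‖s‖) {T Lc : ℕ} (hT1 : 1 ≤ T) (hTLc : T ≤ (Lc + 1) * (Lc + 2) / 2) (hLcD : Lc < D)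
    {Y U M : ℝ}
    (hO : ∀ t : Fin L.m → CX, (∀ j ∈ (L.cfg K hK).orb j₀, t j ∈ nrBody D ξ η r s Y U T) →
      ∏ j ∈ (L.cfg K hK).orb j₀, ‖eval (L.α j) (t j)‖ / ‖L.α j‖ ^ D ≤ M)
    (hpos : ∀ q ∈ (L.algPt j₀).conj, ∀ i : ℕ, i < T → 0 < pdist q (gamP ξ η r s i)) :
    ∃ ι : PPt → ℕ, (∀ q, ι q < T) ∧
      (∀ q, ∀ i : ℕ, i < T → pdist q (gamP ξ η r s (ι q)) ≤ pdist q (gamP ξ η r s i)) ∧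
      ∑ q ∈ (L.algPt j₀).conj,
          (Y - Real.log (2 * c10 ξ η r s Lc) + Real.log (pdist q (gamP ξ η r s (ι q)))) ≤
        Real.log M := by
  set O := (L.cfg K hK).orb j₀ with hOdef
  -- the closest-point index
  have hne : (range T).Nonempty := ⟨0, mem_range.mpr hT1⟩
  have hclosest : ∀ q : PPt, ∃ i, i < T ∧
      ∀ i' : ℕ, i' < T → pdist q (gamP ξ η r s i) ≤ pdist q (gamP ξ η r s i') := by
    intro q
    obtain ⟨i, hi, hmin⟩ := exists_min_image (range T) (fun i => pdist q (gamP ξ η r s i)) hne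
    exact ⟨i, mem_range.mp hi, fun i' hi' => hmin i' (mem_range.mpr hi')⟩
  choose ι hιT hιmin using hclosest
  refine ⟨ι, hιT, hιmin, ?_⟩
  have hc := c10_pos ξ η r hs Lc
  -- the distances `d_j > 0` of the points of the orbit
  have hconj : (L.algPt j₀).conj = O.image L.pt := (L.image_orb_pt_eq_conj K hK j₀).symm
  have hdpos : ∀ j ∈ O, 0 < pdist (L.pt j) (gamP ξ η r s (ι (L.pt j))) := fun j hj =>
    hpos (L.pt j) (by rw [hconj]; exact mem_image_of_mem _ hj) _ (hιT _)
  -- the tests `P_j`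
  have htest : ∀ j ∈ O, ∃ P : CX, P.IsHomogeneous D ∧
      (∀ i : ℕ, i < T → eval (gvec ξ η r s i) P = 0) ∧
      l1Norm P * ‖L.α j‖ ^ D * (pdist (L.pt j) (gamP ξ η r s (ι (L.pt j))) / (2 * c10 ξ η r s Lc)) <
        ‖eval (L.α j) P‖ := fun j hj =>
    exists_test_of_pdist_pos hr hη hs hT1 hTLc hLcD (L.α_ne_zero j) (hdpos j hj)
      fun i hi => hιmin (L.pt j) i hi
  choose! P hPh hPv hPlt using htest
  have hP0 : ∀ j ∈ O, P j ≠ 0 := by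
    intro j hj h0
    have h := hPlt j hj
    rw [h0, map_zero, norm_zero, l1Norm_zero, zero_mul, zero_mul] at h
    exact lt_irrefl _ h
  -- the family `R_j = (e^Y/𝓛(P_j)) P_j ∈ 𝒞`
  set t : Fin L.m → CX := fun j => (((Real.exp Y / l1Norm (P j) : ℝ) : ℂ)) • P j with htdef
  have ht : ∀ j ∈ O, t j ∈ nrBody D ξ η r s Y U T := fun j hj =>
    smul_mem_nrBody (hPh j hj) (hP0 j hj) (hPv j hj)
  have hbound := hO t ht
  -- lower bound for each factor
  have hfac : ∀ j ∈ O, Real.exp Y * (pdist (L.pt j) (gamP ξ η r s (ι (L.pt j))) /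
      (2 * c10 ξ η r s Lc)) ≤ ‖eval (L.α j) (t j)‖ / ‖L.α j‖ ^ D := by
    intro j hj
    have hl : 0 < l1Norm (P j) := l1Norm_pos_of_ne_zero (hP0 j hj)
    have hα : 0 < ‖L.α j‖ ^ D := pow_pos (norm_pos_iff.mpr (L.α_ne_zero j)) _
    have hev : ‖eval (L.α j) (t j)‖ = Real.exp Y / l1Norm (P j) * ‖eval (L.α j) (P j)‖ := by
      rw [htdef]
      simp only
      rw [smul_eq_C_mul, map_mul, eval_C, norm_mul, Complex.norm_real, Real.norm_eq_abs,
        abs_of_pos (div_pos (Real.exp_pos Y) hl)]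
    rw [hev, le_div_iff₀ hα]
    have h := (hPlt j hj).le
    calc Real.exp Y * (pdist (L.pt j) (gamP ξ η r s (ι (L.pt j))) / (2 * c10 ξ η r s Lc)) *
          ‖L.α j‖ ^ D
        = Real.exp Y / l1Norm (P j) * (l1Norm (P j) * ‖L.α j‖ ^ D *
            (pdist (L.pt j) (gamP ξ η r s (ι (L.pt j))) / (2 * c10 ξ η r s Lc))) := by
          field_simp
      _ ≤ Real.exp Y / l1Norm (P j) * ‖eval (L.α j) (P j)‖ :=
          mul_le_mul_of_nonneg_left h (div_pos (Real.exp_pos Y) hl).le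
  have hfacpos : ∀ j ∈ O, 0 < Real.exp Y * (pdist (L.pt j) (gamP ξ η r s (ι (L.pt j))) /
      (2 * c10 ξ η r s Lc)) := fun j hj => mul_pos (Real.exp_pos Y) (div_pos (hdpos j hj) (by positivity))
  have hprod : ∏ j ∈ O, Real.exp Y * (pdist (L.pt j) (gamP ξ η r s (ι (L.pt j))) /
      (2 * c10 ξ η r s Lc)) ≤ M :=
    (prod_le_prod (fun j hj => (hfacpos j hj).le) hfac).trans hbound
  have hlog := Real.log_le_log (prod_pos hfacpos) hprod
  rw [Real.log_prod (s := O) (fun j hj => (hfacpos j hj).ne')] at hlog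
  -- rewrite the sum over `conj Z_D`
  rw [hconj, sum_image fun i _ j _ h => L.pt_injective h]
  refine le_trans (le_of_eq (sum_congr rfl fun j hj => ?_)) hlog
  rw [Real.log_mul (Real.exp_pos Y).ne' (div_pos (hdpos j hj) (by positivity)).ne', Real.log_exp,
    Real.log_div (hdpos j hj).ne' (by positivity)]
  ring

end PairPkg

end NguyenRoy

end Literature.NumberTheory.Transcendental
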